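import Summits.MatrixMultiplication.MatrixMultiplication.Theorems.SnLevelDesigns.Negative.DeadCorners
import Summits.MatrixMultiplication.MatrixMultiplication.Theorems.SnLevelDesigns.Negative.DimensionWalls
import Summits.MatrixMultiplication.MatrixMultiplication.Theorems.LevelTwoBeatsCubes.Negative.GradedNeumannCount

/-!
# `SnLevelDesigns` (crux stmt-MatrixMultiplication-7613, route `LevelGradedCohnUmans`):
# the graded Neumann count at every token level (negative-side support, refuter cdisprove seat)

Sorry-free.  Instantiates the sibling crux's graded Neumann count
(`LevelTwoBeatsCubes.Negative.packing_X/packing_Z/vol_le`, refuter of stmt-7612) at the `k`-token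
space `T_k = tokenSpace n k` for `k`-token separated triples (`Sep n k X Y Z`, the crux's clause):
`neumann_X : |X||Z| + |X|(|Y|-1) ≤ dim T_k`, `neumann_Z : |X||Z| + (|Y|-1)|Z| ≤ dim T_k`, and
`volume_le_of_cubic_budget : (∀ p, p·dim T_k + p² ≤ p³ + B) → |X||Y||Z| ≤ B`, i.e.
`|X||Y||Z| ≤ (2/(3√3))·(dim T_k)^{3/2}·(1 + o(1))` at EVERY level — constant `0.385` in place of the
`1` of the plain dimension walls (`DimensionWalls.lean`).  Consequence (asymptotic in `n`, with
`dim T_k = ∑_{μ₁ ≥ n-k}(f^μ)² ≈ n^{2k}/k!`): each fixed level `k` is dead for `ε < ε_k`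
(`ε_2 ≈ 22.5`, `ε_3 = ∞`, `ε_4 ≈ 2.5`, `ε_7 ≈ 0.9`, `ε_14 ≈ 0.4`), so a witness family for the crux must have
`k(ε) → ∞`; see `Cruxes/SnLevelDesigns/Disproof.lean` for the table and why this is not a kill.
-/

namespace Summit.MatrixMultiplication.MatrixMultiplication.Theorems.SnLevelDesigns.Negative

open scoped BigOperators

noncomputable section

/-! ## Graded Neumann count at every level (after the sibling refutation of `LevelTwoBeatsCubes`)

The refuter of stmt-7612 landed `LevelTwoBeatsCubes.Negative.GradedNeumannCount`: for a triple
separated by a right- (left-) invariant `J`, `|X||Z| + |X|(|Y|-1) ≤ dim J`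
(`|X||Z| + (|Y|-1)|Z| ≤ dim J`), whence `|X||Y||Z| ≤ pD + p² - p³ ≤ (2/(3√3)) D^{3/2} + D/3`,
`p = min(|X|,|Z|)`, `D = dim J`.  Instantiated at `J = T_k` this supersedes the three walls above
(constant `0.385` instead of `1` in `V ≤ c·(dim T_k)^{3/2}`) at EVERY level `k`:
asymptotically in `n` (with `dim T_k = D_k(n) ≈ n^{2k}/k!` and
`budget_k(ε) ≈ ρ_k(ε) D_k^{1+ε/2}`, `ρ_k(ε) = ∑_{ν ⊢ k} (f^ν)^{2+ε}/(k!)^{1+ε/2}`), level `k` is DEAD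
whenever `0.385^{(2+ε)/3} ≤ ρ_k(ε)`: level 2 for `ε < 22.5`, level 3 for EVERY `ε`, level 4 for `ε < 2.51`,
5: `ε < 1.37`, 6: `1.17`, 7: `0.91`, 8: `0.74`, 9: `0.64`, 10: `0.58`, 12: `0.48`, 14: `0.41`
(`compute` table in NOTES; `ε_k ≈ 6/k`).  So ANY witness family for the crux has `k(ε) → ∞`
(roughly `k ≳ 6/ε`) — but since `ρ_k(ε) → 0` as `k → ∞` for fixed `ε` (Plancherel-typical
`f^ν ≈ √(k!) e^{-c√k}`), the graded Neumann count does NOT close the large-`k` window: no kill. -/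

/-- Graded Neumann count for `k`-token separation, `X`-slab: `|X||Z| + |X|(|Y|-1) ≤ dim T_k`. -/
theorem neumann_X {n k : ℕ} {X Y Z : Finset (Equiv.Perm (Fin n))} (h : Sep n k X Y Z)
    (hY : Y.Nonempty) (hZ : Z.Nonempty) :
    X.card * Z.card + X.card * (Y.card - 1) ≤ Module.finrank ℂ (tokenSpace n k) := by
  obtain ⟨y₁, hy₁⟩ := hY
  obtain ⟨z₁, hz₁⟩ := hZ
  refine Summit.MatrixMultiplication.MatrixMultiplication.Theorems.LevelTwoBeatsCubes.Negative.packing_X (tokenSpace n k) ?_ X Y Z ?_ hy₁ hz₁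
  · intro f hf g'
    have : (fun g => f (g * g')) = fun g => f (1 * g * g') := by simp only [one_mul]
    rw [this]; exact translate_mem_tokenSpace hf 1 g'
  · intro x₀ hx₀ z₀ hz₀
    obtain ⟨c, hc⟩ := h x₀ hx₀ z₀ hz₀
    refine ⟨tokenFn c, tokenFn_mem_tokenSpace c, fun x hx y hy y' hy' z hz => ?_⟩
    have hv := hc x hx y hy y' hy' z hz
    change tokenFn c (x⁻¹ * y * y'⁻¹ * z) = _ at hv
    constructor
    · intro hcond; rw [hv, if_pos hcond]
    · intro hcond; rw [hv, if_neg hcond]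

/-- Graded Neumann count for `k`-token separation, `Z`-slab: `|X||Z| + (|Y|-1)|Z| ≤ dim T_k`. -/
theorem neumann_Z {n k : ℕ} {X Y Z : Finset (Equiv.Perm (Fin n))} (h : Sep n k X Y Z)
    (hX : X.Nonempty) (hY : Y.Nonempty) :
    X.card * Z.card + (Y.card - 1) * Z.card ≤ Module.finrank ℂ (tokenSpace n k) := by
  obtain ⟨x₁, hx₁⟩ := hX
  obtain ⟨y₁, hy₁⟩ := hY
  refine Summit.MatrixMultiplication.MatrixMultiplication.Theorems.LevelTwoBeatsCubes.Negative.packing_Z (tokenSpace n k) ?_ X Y Z ?_ hx₁ hy₁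
  · intro f hf g'
    have : (fun g => f (g' * g)) = fun g => f (g' * g * 1) := by simp only [mul_one]
    rw [this]; exact translate_mem_tokenSpace hf g' 1
  · intro x₀ hx₀ z₀ hz₀
    obtain ⟨c, hc⟩ := h x₀ hx₀ z₀ hz₀
    refine ⟨tokenFn c, tokenFn_mem_tokenSpace c, fun x hx y hy y' hy' z hz => ?_⟩
    have hv := hc x hx y hy y' hy' z hz
    change tokenFn c (x⁻¹ * y * y'⁻¹ * z) = _ at hv
    constructor
    · intro hcond; rw [hv, if_pos hcond]
    · intro hcond; rw [hv, if_neg hcond]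

/-- **Cubic volume budget at every level**: if `B` dominates `p·dim T_k + p² - p³` for all `p`, then
every `k`-token separated triple has `|X||Y||Z| ≤ B` (graded Neumann + `vol_le` of the sibling file).
Asymptotically the least such `B` is `(2/(3√3)) (dim T_k)^{3/2} (1 + o(1))`. -/
theorem volume_le_of_cubic_budget {n k : ℕ} {X Y Z : Finset (Equiv.Perm (Fin n))} (h : Sep n k X Y Z)
    (B : ℕ) (hB : ∀ p : ℕ, p * Module.finrank ℂ (tokenSpace n k) + p ^ 2 ≤ p ^ 3 + B) :
    X.card * Y.card * Z.card ≤ B := by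
  classical
  rcases X.eq_empty_or_nonempty with hX | hX
  · simp [hX]
  rcases Y.eq_empty_or_nonempty with hY | hY
  · simp [hY]
  rcases Z.eq_empty_or_nonempty with hZ | hZ
  · simp [hZ]
  exact Summit.MatrixMultiplication.MatrixMultiplication.Theorems.LevelTwoBeatsCubes.Negative.vol_le X.card Y.card Z.card _ B hY.card_pos
    (neumann_X h hY hZ) (neumann_Z h hX hY) hB

end

end Summit.MatrixMultiplication.MatrixMultiplication.Theorems.SnLevelDesigns.Negative
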